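import Summits.QuantumAdvantage.QuantumAdvantage.Theses.CubicForrelation
import Literature.Computability.QuantumComplexity.SignedCubicForrelation
import Summits.QuantumAdvantage.QuantumAdvantage.Theorems.CubicForrelationSignedExactCubicForrelationNotPrBPPStubNoTrapTemplateLemmas2

/-!
# Crux `CubicForrelation.SignedExactCubicForrelationNotPrBPP` (stmt-QuantumAdvantage-13932) — stub `stub_noTrapTemplate`

The NO-TRAP THEOREM of the GROW finder of line `dual-pingpong-frame`, in Maiorana–McFarland TEMPLATE coordinates.
Let `b(y', y'') = y'·π(y'') ⊕ h(y'')` and `a(x', x'') = x''·σ(x') ⊕ h(σ x') ⊕ c` on `𝔽₂^{m+m}` (`σ = π⁻¹`, both with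
coordinatewise-quadratic coordinates, `a`, `b` of degree `≤ 3`), and let `(S, U)` be a pair of subspaces which is CLOSED for
`b` from `S` into `U` (slice rows `k ↦ D_{e_k} D_s D_y b (0)` in `U`, offsets `r ↦ D_s D_r b (0)` on `rad B_s` represented
in `U`), CLOSED for `a` from `U` into `S`, and ORTHOGONAL. Then `S` extends to an M-subspace `V*` of `b` (`|V*|² = 2^{2m}`,
all `D_u D_v b ≡ 0` on `V*`) with `V* ⊥ U`.

Proof (lead's note NT.md; helper files `…StubNoTrapTemplateLemmas{,2}.lean`). Write `s'' = proj''(s)`, `u' = proj'(u)`,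
`U' = proj'(U)`, `S'' = proj''(S)`, `c_t = π t ⊕ π 0`, `B_π(t, ·)` the (linear) polar form of `π` at `t`.
1. Frame law `b X ⊕ b (X ⊕ (g,0)) = g·π(X'')` (`PolarGeometry.xor_frame_eq`), dually `a X ⊕ a (X ⊕ (0,r)) = r·σ(X')`; the
   abstract frame lemmas give `B_π(s'', t) ∈ U'`, `c_{s''} ∈ U'` (`s ∈ S`) and `σ u' ⊕ σ 0 ∈ S''` (`u ∈ U`)
   (`NoTrap.frame_row_mem`, `NoTrap.frame_offset_mem`).
2. Hence `t ↦ c_t` injects `S''` into `U'` and `u' ↦ σ u' ⊕ σ 0` injects `U'` into `S''`: `|U'| = |S''|`.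
3. `G := (U')^⊥`, `V* := {s ⊕ (g, 0) : s ∈ S, g ∈ G}`. Flatness: `S` is flat (closed + orthogonal, `NoTrap.flat_of_closed_orth`),
   `D_s D_{(g,0)} b (X) = g·π(X'') ⊕ g·π(X'' ⊕ s'') = g·B_π(s'',X'') ⊕ g·c_{s''} = 0` for `g ⊥ U'`, `D_{(g,0)} D_{(g',0)} b = 0`;
   the cocycle law spreads this over `V*`. Orthogonality: `(s ⊕ (g,0))·u = s·u ⊕ g·u' = 0`.
4. Counting: `proj''(V*) = S''` and `V* ∩ ker proj'' = G × 0` (a vector `(w',0) ∈ S` has `w' ⊥ U'` by orthogonality), so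
   `|V*| = |S''|·|G| = |U'|·|(U')^⊥| = 2^m` (`NoTrap.card_eq_card_image_mul_card_ker`, `DerivativeWalsh.card_mul_card_perp`).

References: C. Carlet, *Boolean Functions for Cryptography and Coding Theory*, CUP 2020, Prop. 54 (Maiorana–McFarland class,
M-subspaces), Prop. 77 (duals), §5.2 [Carlet2020]; R. O'Donnell, *Analysis of Boolean Functions*, CUP 2014, §3.3 [ODonnell2014].
-/

noncomputable section

set_option linter.dupNamespace false -- D-0017: single-problem summit ⇒ `QuantumAdvantage.QuantumAdvantage` by design

namespace Summit.QuantumAdvantage.QuantumAdvantage.Theorems.SignedExactCubicForrelationNotPrBPP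

open Finset
open Literature.Computability.Complexity Literature.Computability.QuantumComplexity
open Literature.Computability.QuantumComplexity.BuzetChailloux (bxor zeroVec bxor_self bxor_comm
  bxor_zeroVec zeroVec_bxor)
open PolarGeometry (bdot_comm bdot_bxor_left bdot_bxor_right twist_eq_one_iff_bdot exists_append bxor_append
  xor_frame_eq)
open NoTrap

namespace NoTrap

variable {m : ℕ}

/-- **Frame law of the template `b(y', y'') = y'·π(y'') ⊕ h(y'')`**: `b X ⊕ b (X ⊕ (g, 0)) = g·π(X'')`.
[cite: Carlet2020, Prop. 54] -/
theorem frameLaw_b {b : (Fin (m + m) → Bool) → Bool} {π : (Fin m → Bool) → Fin m → Bool} {h : (Fin m → Bool) → Bool}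
    (hb : ∀ y' y'' : Fin m → Bool,
      b (Fin.append y' y'') = ((Finset.univ.filter fun i => y' i && (π y'') i).card.bodd ^^ h y'')) :
    ∀ (X : Fin (m + m) → Bool) (g : Fin m → Bool), (b X ^^ b (bxor X (Fin.append g zeroVec))) =
      (univ.filter fun i => g i && π (fun j => X (Fin.natAdd m j)) i).card.bodd := by
  intro X g
  obtain ⟨x', x'', rfl⟩ := exists_append X
  rw [bxor_append, bxor_zeroVec, xor_frame_eq hb g x' x'']
  simp only [Fin.append_right]

/-- **Frame law of the dual template `a(x', x'') = x''·σ(x') ⊕ h(σ x') ⊕ c`**: `a X ⊕ a (X ⊕ (0, r)) = r·σ(X')`.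
[cite: Carlet2020, Prop. 77] -/
theorem frameLaw_a {a : (Fin (m + m) → Bool) → Bool} {σ : (Fin m → Bool) → Fin m → Bool} {h : (Fin m → Bool) → Bool}
    {c : Bool}
    (ha : ∀ x' x'' : Fin m → Bool,
      a (Fin.append x' x'') = ((Finset.univ.filter fun i => x'' i && (σ x') i).card.bodd ^^ h (σ x') ^^ c)) :
    ∀ (X : Fin (m + m) → Bool) (r : Fin m → Bool), (a X ^^ a (bxor X (Fin.append zeroVec r))) =
      (univ.filter fun i => r i && σ (fun j => X (Fin.castAdd m j)) i).card.bodd := by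
  intro X r
  obtain ⟨x', x'', rfl⟩ := exists_append X
  rw [bxor_append, bxor_zeroVec, ha, ha, bdot_bxor_left]
  simp only [Fin.append_left]
  generalize (univ.filter fun i => x'' i && σ x' i).card.bodd = P
  generalize (univ.filter fun i => r i && σ x' i).card.bodd = R
  generalize h (σ x') = H
  clear ha
  revert P R H c; decide

/-- `(x ⊕ z) = (y ⊕ z) → x = y` in `𝔽₂`. [folklore] -/
theorem xor_right_cancel' {x y z : Bool} (h : (x ^^ z) = (y ^^ z)) : x = y := by
  revert x y z h; decide

end NoTrap

/-- **No-trap theorem in template coordinates** (stub `stub_noTrapTemplate` of line `dual-pingpong-frame`, crux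
stmt-QuantumAdvantage-13932): for the Maiorana–McFarland template `b = y'·π(y'') ⊕ h(y'')` with dual shape
`a = x''·σ(x') ⊕ h(σ x') ⊕ c` (`σ = π⁻¹`; `π`, `σ` with quadratic coordinates; `a`, `b` cubic), every pair `(S, U)` of
subspaces which is closed for `b` from `S` into `U`, closed for `a` from `U` into `S`, and orthogonal extends to an
M-subspace `V* ⊇ S` of `b` with `V* ⊥ U`; explicitly `V* = S + ((proj' U)^⊥ × 0)`, and `|V*| = 2^m` by the chain
`|S''| ≤ |U'| ≤ |S''|` (injectivity of `t ↦ π t ⊕ π 0` into `U'` and of `u' ↦ σ u' ⊕ σ 0` into `S''`).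
[cite: Carlet2020, Prop. 54] -/
theorem stub_noTrapTemplate :
    ∀ (m : ℕ) (a b : (Fin (m + m) → Bool) → Bool) (π : (Fin m → Bool) ≃ (Fin m → Bool))
        (h : (Fin m → Bool) → Bool) (c : Bool),
        (∀ i, IsDegLeFun 2 fun y => π y i) → (∀ i, IsDegLeFun 2 fun x => π.symm x i) →
        IsDegLeFun 3 a → IsDegLeFun 3 b →
        (∀ y' y'' : Fin m → Bool, b (Fin.append y' y'') = (((Finset.univ.filter fun i => y' i && (π y'') i).card.bodd) ^^ h y'')) →
        (∀ x' x'' : Fin m → Bool, a (Fin.append x' x'') =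
          (((Finset.univ.filter fun i => x'' i && (π.symm x') i).card.bodd) ^^ h (π.symm x') ^^ c)) →
        ∀ S U : Finset (Fin (m + m) → Bool),
          (zeroVec ∈ S ∧ ∀ x ∈ S, ∀ y ∈ S, bxor x y ∈ S) → (zeroVec ∈ U ∧ ∀ x ∈ U, ∀ y ∈ U, bxor x y ∈ U) →
          ((∀ s ∈ S, ∀ y : Fin (m + m) → Bool, (fun k => (b zeroVec ^^ b (bxor zeroVec s) ^^ b (bxor zeroVec y) ^^ b (bxor zeroVec (bxor s y))) ^^ (b (fun j => decide (j = k)) ^^ b (bxor (fun j => decide (j = k)) s) ^^ b (bxor (fun j => decide (j = k)) y) ^^ b (bxor (fun j => decide (j = k)) (bxor s y)))) ∈ U) ∧ (∀ s ∈ S, ∃ ℓ ∈ U, ∀ r : Fin (m + m) → Bool, (∀ y z : Fin (m + m) → Bool, ((b z ^^ b (bxor z s) ^^ b (bxor z r) ^^ b (bxor z (bxor s r))) ^^ (b (bxor z y) ^^ b (bxor (bxor z y) s) ^^ b (bxor (bxor z y) r) ^^ b (bxor (bxor z y) (bxor s r)))) = false) → (b r ^^ b (bxor r s) ^^ b zeroVec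 ^^ b s) = ((Finset.univ.filter fun i => ℓ i && r i).card).bodd)) →
          ((∀ s ∈ U, ∀ y : Fin (m + m) → Bool, (fun k => (a zeroVec ^^ a (bxor zeroVec s) ^^ a (bxor zeroVec y) ^^ a (bxor zeroVec (bxor s y))) ^^ (a (fun j => decide (j = k)) ^^ a (bxor (fun j => decide (j = k)) s) ^^ a (bxor (fun j => decide (j = k)) y) ^^ a (bxor (fun j => decide (j = k)) (bxor s y)))) ∈ S) ∧ (∀ s ∈ U, ∃ ℓ ∈ S, ∀ r : Fin (m + m) → Bool, (∀ y z : Fin (m + m) → Bool, ((a z ^^ a (bxor z s) ^^ a (bxor z r) ^^ a (bxor z (bxor s r))) ^^ (a (bxor z y) ^^ a (bxor (bxor z y) s) ^^ a (bxor (bxor z y) r) ^^ a (bxor (bxor z y) (bxor s r)))) = false) → (a r ^^ a (bxor r s) ^^ a zeroVec ^^ a s) = ((Finset.univ.filter fun i => ℓ i && r i).card).bodd)) →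
          (∀ s ∈ S, ∀ u ∈ U, ((Finset.univ.filter fun i => s i && u i).card).bodd = false) →
          ∃ V : Finset (Fin (m + m) → Bool), ((zeroVec ∈ V ∧ ∀ x ∈ V, ∀ y ∈ V, bxor x y ∈ V) ∧ (((V).card : ℝ) ^ 2 = (2 : ℝ) ^ (m + m)) ∧ ∀ u ∈ V, ∀ v ∈ V, ∀ x, (b x ^^ b (bxor x u) ^^ b (bxor x v) ^^ b (bxor x (bxor u v))) = false) ∧ S ⊆ V ∧ (∀ s ∈ V, ∀ u ∈ U, ((Finset.univ.filter fun i => s i && u i).card).bodd = false) := by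
  intro m a b π h c hπ hσ ha hb hbdef hadef S U hS hU hcb hca ho
  obtain ⟨hS0, hSadd⟩ := hS
  obtain ⟨hU0, hUadd⟩ := hU
  -- second differences of `b` and `a` as opaque functions
  obtain ⟨D, hD⟩ : ∃ D : (Fin (m + m) → Bool) → (Fin (m + m) → Bool) → (Fin (m + m) → Bool) → Bool,
      ∀ u v x, D u v x = (b x ^^ b (bxor x u) ^^ b (bxor x v) ^^ b (bxor x (bxor u v))) := ⟨_, fun _ _ _ => rfl⟩
  obtain ⟨Da, hDa⟩ : ∃ Da : (Fin (m + m) → Bool) → (Fin (m + m) → Bool) → (Fin (m + m) → Bool) → Bool,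
      ∀ u v x, Da u v x = (a x ^^ a (bxor x u) ^^ a (bxor x v) ^^ a (bxor x (bxor u v))) := ⟨_, fun _ _ _ => rfl⟩
  simp only [← hD] at hcb
  simp only [← hDa] at hca
  obtain ⟨hrow, hoff⟩ := hcb
  obtain ⟨hrowa, hoffa⟩ := hca
  -- the frame embedding `ι g = (g, 0)` and the projection `pb X = X''`
  obtain ⟨ι, hι⟩ : ∃ ι : (Fin m → Bool) → (Fin (m + m) → Bool), ∀ g, ι g = Fin.append g zeroVec := ⟨_, fun _ => rfl⟩
  obtain ⟨pb, hpb⟩ : ∃ pb : (Fin (m + m) → Bool) → (Fin m → Bool), ∀ X, pb X = fun j => X (Fin.natAdd m j) :=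
    ⟨_, fun _ => rfl⟩
  have hpb' : pb = fun X j => X (Fin.natAdd m j) := funext hpb
  have hFb : ∀ (X : Fin (m + m) → Bool) (g : Fin m → Bool),
      (b X ^^ b (bxor X (ι g))) = (univ.filter fun i => g i && π (pb X) i).card.bodd := fun X g => by
    rw [hι, hpb]; exact frameLaw_b hbdef X g
  have hpadd : ∀ X Y, pb (bxor X Y) = bxor (pb X) (pb Y) := fun X Y => by rw [hpb, hpb, hpb]
  have hp0 : pb zeroVec = zeroVec := by rw [hpb]; rfl
  have hκ : ∀ (g : Fin m → Bool) (u : Fin (m + m) → Bool), (univ.filter fun i => ι g i && u i).card.bodd =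
      (univ.filter fun i => g i && u (Fin.castAdd m i)).card.bodd := fun g u => by
    rw [hι]; exact bdot_append_zeroVec g u
  have hsurj : ∀ t, ∃ X, pb X = t := fun t =>
    ⟨Fin.append zeroVec t, by rw [hpb]; funext j; exact Fin.append_right _ _ j⟩
  have hunit : ∀ i, ι (fun j => decide (j = i)) = fun j => decide (j = Fin.castAdd m i) := fun i => by
    rw [hι]; exact (unitVec_castAdd i).symm
  have hpι : ∀ g, pb (ι g) = zeroVec := fun g => by
    rw [hpb, hι]; funext j; exact Fin.append_right _ _ j
  have hιadd : ∀ g g', bxor (ι g) (ι g') = ι (bxor g g') := fun g g' => by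
    rw [hι, hι, hι, bxor_append, bxor_self]
  have hι0 : ι zeroVec = zeroVec := by rw [hι]; exact append_zeroVec_zeroVec
  have hιinj : Function.Injective ι := fun g g' hgg => by
    rw [hι, hι] at hgg
    funext i
    have := congrFun hgg (Fin.castAdd m i)
    rwa [Fin.append_left, Fin.append_left] at this
  have hsplit : ∀ X, pb X = zeroVec → X = ι (fun i => X (Fin.castAdd m i)) := fun X hX => by
    rw [hι]; rw [hpb] at hX; exact eq_append_of_right_eq_zeroVec X hX
  -- Step 1: the frame consequences of closedness
  have rowU : ∀ s ∈ S, ∀ t, (fun i => (π (bxor (pb s) t) i ^^ π (pb s) i ^^ π t i ^^ π zeroVec i)) ∈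
      U.image (fun u i => u (Fin.castAdd m i)) := frame_row_mem D hD hπ hFb hpadd hsurj hunit hrow
  have offU : ∀ s ∈ S, (fun i => (π (pb s) i ^^ π zeroVec i)) ∈ U.image (fun u i => u (Fin.castAdd m i)) :=
    frame_offset_mem D hD hπ hFb hpadd hp0 hκ hsurj hunit hUadd hrow hoff
  have offS : ∀ u ∈ U, (fun j => (π.symm (fun i => u (Fin.castAdd m i)) j ^^ π.symm zeroVec j)) ∈
      S.image (fun s j => s (Fin.natAdd m j)) :=
    frame_offset_mem (F := fun r => Fin.append zeroVec r) (p := fun X i => X (Fin.castAdd m i)) (π := ⇑π.symm)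
      (κ := Fin.natAdd m) Da hDa hσ (frameLaw_a hadef) (fun _ _ => rfl) rfl (fun r u => bdot_zeroVec_append r u)
      (fun t => ⟨Fin.append t zeroVec, funext fun i => Fin.append_left t zeroVec i⟩)
      (fun i => (unitVec_natAdd i).symm) hSadd hrowa hoffa
  -- Step 2: `G = (U')^⊥`
  obtain ⟨G, hG⟩ : ∃ G : Finset (Fin m → Bool),
      G = univ.filter fun g => ∀ x ∈ U.image (fun u i => u (Fin.castAdd m i)), twist x g = 1 := ⟨_, rfl⟩
  have hGU' : ∀ g ∈ G, ∀ x ∈ U.image (fun u i => u (Fin.castAdd m i)),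
      (univ.filter fun i => g i && x i).card.bodd = false := fun g hg x hx => by
    rw [hG] at hg
    have := (mem_filter.1 hg).2 x hx
    rwa [twist_eq_one_iff_bdot, bdot_comm] at this
  have hGU : ∀ g ∈ G, ∀ u ∈ U, (univ.filter fun i => g i && u (Fin.castAdd m i)).card.bodd = false :=
    fun g hg u hu => hGU' g hg _ (mem_image_of_mem _ hu)
  have hmemG : ∀ g, (∀ u ∈ U, (univ.filter fun i => g i && u (Fin.castAdd m i)).card.bodd = false) → g ∈ G := by
    intro g hg
    rw [hG]
    refine mem_filter.2 ⟨mem_univ _, fun x hx => ?_⟩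
    obtain ⟨u, hu, rfl⟩ := mem_image.1 hx
    rw [twist_eq_one_iff_bdot, bdot_comm]
    exact hg u hu
  obtain ⟨hG0, hGadd⟩ : zeroVec ∈ G ∧ ∀ x ∈ G, ∀ y ∈ G, bxor x y ∈ G := by
    rw [hG]; exact DerivativeWalsh.bxor_mem_perp _
  -- Step 3: flatness of the generators
  have flatS : ∀ s ∈ S, ∀ s₂ ∈ S, ∀ x, D s s₂ x = false := flat_of_closed_orth hb D hD hrow hoff ho
  have cross : ∀ s ∈ S, ∀ g ∈ G, ∀ X, D s (ι g) X = false := by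
    intro s hs g hg X
    rw [frame_D2 D hD hFb hpadd s X g, bxor_comm (pb X) (pb s)]
    have h1 := hGU' g hg _ (rowU s hs (pb X))
    have h2 := hGU' g hg _ (offU s hs)
    rw [bdot_xor4_right] at h1
    rw [bdot_xor_right] at h2
    revert h1 h2
    generalize (univ.filter fun i => g i && π (bxor (pb s) (pb X)) i).card.bodd = A
    generalize (univ.filter fun i => g i && π (pb s) i).card.bodd = B
    generalize (univ.filter fun i => g i && π (pb X) i).card.bodd = C
    generalize (univ.filter fun i => g i && π zeroVec i).card.bodd = E
    revert A B C E; decide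
  have frameflat : ∀ g g' X, D (ι g) (ι g') X = false := fun g g' X => by
    rw [frame_D2 D hD hFb hpadd (ι g) X g', hpι, bxor_zeroVec, Bool.xor_self]
  -- Step 4: `V* = S + ι(G)`
  obtain ⟨V, hV⟩ : ∃ V : Finset (Fin (m + m) → Bool), V = (S ×ˢ G).image (fun q => bxor q.1 (ι q.2)) := ⟨_, rfl⟩
  have hmemV : ∀ x, x ∈ V ↔ ∃ s ∈ S, ∃ g ∈ G, bxor s (ι g) = x := fun x => by
    rw [hV, mem_image]
    constructor
    · rintro ⟨⟨s, g⟩, hq, rfl⟩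
      exact ⟨s, (mem_product.1 hq).1, g, (mem_product.1 hq).2, rfl⟩
    · rintro ⟨s, hs, g, hg, rfl⟩
      exact ⟨(s, g), mem_product.2 ⟨hs, hg⟩, rfl⟩
  have hV0 : zeroVec ∈ V := (hmemV _).2 ⟨zeroVec, hS0, zeroVec, hG0, by rw [hι0, bxor_self]⟩
  have hVadd : ∀ x ∈ V, ∀ y ∈ V, bxor x y ∈ V := by
    intro x hx y hy
    obtain ⟨s, hs, g, hg, rfl⟩ := (hmemV x).1 hx
    obtain ⟨s', hs', g', hg', rfl⟩ := (hmemV y).1 hy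
    refine (hmemV _).2 ⟨bxor s s', hSadd _ hs _ hs', bxor g g', hGadd _ hg _ hg', ?_⟩
    rw [← hιadd]
    show (s + s') + (ι g + ι g') = (s + ι g) + (s' + ι g')
    abel
  have hSV : S ⊆ V := fun s hs => (hmemV s).2 ⟨s, hs, zeroVec, hG0, by rw [hι0, bxor_zeroVec]⟩
  have hgen : ∀ v ∈ V, ∀ w, (w ∈ S ∨ ∃ g ∈ G, ι g = w) → ∀ x, D v w x = false := by
    intro v hv w hw x
    obtain ⟨s, hs, g, hg, rfl⟩ := (hmemV v).1 hv
    rw [D_bxor_left D hD]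
    rcases hw with hw | ⟨g', hg', rfl⟩
    · rw [flatS s hs w hw, D_symm D hD (ι g) w, cross w hw g hg]; rfl
    · rw [cross s hs g' hg', frameflat]; rfl
  have hflatV : ∀ u ∈ V, ∀ v ∈ V, ∀ x, D u v x = false := by
    intro u hu v hv x
    obtain ⟨s, hs, g, hg, rfl⟩ := (hmemV v).1 hv
    rw [D_symm D hD, D_bxor_left D hD, D_symm D hD s u, hgen u hu s (Or.inl hs), D_symm D hD (ι g) u,
      hgen u hu (ι g) (Or.inr ⟨g, hg, rfl⟩)]
    rfl
  have horthV : ∀ x ∈ V, ∀ u ∈ U, (univ.filter fun i => x i && u i).card.bodd = false := by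
    intro x hx u hu
    obtain ⟨s, hs, g, hg, rfl⟩ := (hmemV x).1 hx
    rw [bdot_bxor_left, ho s hs u hu, hκ g u, hGU g hg u hu]
    rfl
  -- Step 5: counting `|V*| = |S''|·|G| = |U'|·|G| = 2^m`
  have hVimg : V.image pb = S.image pb := by
    ext t
    constructor
    · intro ht
      obtain ⟨x, hx, rfl⟩ := mem_image.1 ht
      obtain ⟨s, hs, g, hg, rfl⟩ := (hmemV x).1 hx
      exact mem_image.2 ⟨s, hs, by rw [hpadd, hpι, bxor_zeroVec]⟩
    · intro ht
      obtain ⟨s, hs, rfl⟩ := mem_image.1 ht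
      exact mem_image.2 ⟨s, hSV hs, rfl⟩
  have hVker : V.filter (fun x => pb x = zeroVec) = G.image ι := by
    ext x
    constructor
    · intro hx
      obtain ⟨hxV, hx0⟩ := mem_filter.1 hx
      obtain ⟨s, hs, g, hg, rfl⟩ := (hmemV x).1 hxV
      rw [hpadd, hpι, bxor_zeroVec] at hx0
      have hs' : s = ι (fun i => s (Fin.castAdd m i)) := hsplit s hx0
      have hgs : (fun i => s (Fin.castAdd m i)) ∈ G :=
        hmemG _ fun u hu => by rw [← hκ, ← hs']; exact ho s hs u hu
      refine mem_image.2 ⟨bxor (fun i => s (Fin.castAdd m i)) g, hGadd _ hgs _ hg, ?_⟩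
      rw [← hιadd, ← hs']
    · intro hx
      obtain ⟨g, hg, rfl⟩ := mem_image.1 hx
      exact mem_filter.2 ⟨(hmemV _).2 ⟨zeroVec, hS0, g, hg, zeroVec_bxor _⟩, hpι g⟩
  have hcardV : V.card = (S.image pb).card * G.card := by
    rw [card_eq_card_image_mul_card_ker V pb hVadd (fun x _ y _ => hpadd x y), hVimg, hVker,
      card_image_of_injective _ hιinj]
  have hSU : (S.image pb).card ≤ (U.image (fun u i => u (Fin.castAdd m i))).card := by
    refine card_le_card_of_injOn (fun t => fun i => (π t i ^^ π zeroVec i)) (fun t ht => ?_)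
      (fun t _ t' _ htt' => ?_)
    · obtain ⟨s, hs, rfl⟩ := mem_image.1 (mem_coe.1 ht)
      exact mem_coe.2 (offU s hs)
    · apply π.injective
      funext i
      exact xor_right_cancel' (congrFun htt' i)
  have hUS : (U.image (fun u i => u (Fin.castAdd m i))).card ≤ (S.image pb).card := by
    refine card_le_card_of_injOn (fun u' => fun j => (π.symm u' j ^^ π.symm zeroVec j)) (fun u' hu' => ?_)
      (fun t _ t' _ htt' => ?_)
    · obtain ⟨u, hu, rfl⟩ := mem_image.1 (mem_coe.1 hu')
      rw [hpb']
      exact mem_coe.2 (offS u hu)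
    · apply π.symm.injective
      funext i
      exact xor_right_cancel' (congrFun htt' i)
  have hU'0 : zeroVec ∈ U.image (fun u i => u (Fin.castAdd m i)) := mem_image.2 ⟨zeroVec, hU0, rfl⟩
  have hU'add := bxor_mem_image_proj (κ := Fin.castAdd m) hUadd
  have hUG : ((U.image (fun u i => u (Fin.castAdd m i))).card : ℝ) * G.card = (2 : ℝ) ^ m := by
    rw [hG]; exact DerivativeWalsh.card_mul_card_perp hU'0 hU'add
  have hcardR : (V.card : ℝ) = (2 : ℝ) ^ m := by
    rw [hcardV, Nat.cast_mul, le_antisymm hSU hUS, hUG]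
  refine ⟨V, ⟨⟨hV0, hVadd⟩, ?_, fun u hu v hv x => ?_⟩, hSV, horthV⟩
  · rw [hcardR, sq, ← pow_add]
  · have := hflatV u hu v hv x
    rwa [hD] at this

end Summit.QuantumAdvantage.QuantumAdvantage.Theorems.SignedExactCubicForrelationNotPrBPP

end
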